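import Literature.NumberTheory.GaloisCohomology.RestrictedRamificationEulerCharacteristicAdditive
import Literature.NumberTheory.GaloisRepresentations.FiniteQuotientInflation
import HarnessLib

/-!
# Milne's "`φ` is a homomorphism `R_{𝔽_p}(Ḡ) → ℚ_{>0}`" at a totally complex field: the additive
# Euler characteristic of inflated `Ḡ`-modules is additive on short exact sequences of `Ḡ`-modules

Topic `NumberTheory/GaloisCohomology`; namespace `Literature.NumberTheory.GaloisCohomology`.
THEOREMS ONLY (no definition, no named fact, no `sorry`, no instance; D-0026).  Lane «TATE-EPC-TC»
of cell `bsd-eis` (road memo evidence #54 on stmt-BirchSwinnertonDyer-19032), brick (B9-pre) part 2: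
composition of (B1d-γ) `RestrictedRamificationEulerCharacteristicAdditive.lean`
(`restrictedCohomology_eulerChar_add`) with `GaloisRepresentations/FiniteQuotientInflation.lean`
(`DiscreteGaloisModule.inflate`, `isSES_inflateHom`).

Milne, *Arithmetic Duality Theorems*, I §5 (proof of Thm. 5.1, p. 69): "`φ` … is multiplicative in
short exact sequences … let `L` be a finite Galois extension of `K` contained in `K_S` splitting `M`,
`Ḡ = Gal(L/K)` … `φ` therefore defines a homomorphism `R_{𝔽_p}(Ḡ) → ℚ_{>0}`."  Here, for `K`
totally complex, `S ⊇ S_p` finite and a continuous `π : Γ_K →ₜ* Q` onto a discrete group killing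
`N_S` (so `Q`-modules inflate to `G_S`-modules), the `ℤ`-valued invariant

  `ψ(Y) := χ_{p,e}(inflate π Y) = v_p #H⁰(G_S, Y) − v_p #H¹(G_S, Y) + v_p #H²(G_S, Y) + e·v_p #Y`

is ADDITIVE on short exact sequences of finite `Q`-modules killed by `p`
(`eulerChar_inflate_add`), in exactly the `(ψ, hψ)` binder format of the finite-group bricks
(`RepresentationTheory/FiniteGroups/StableLatticeReductionInvariantInt`: arbitrary `Module ℤ`
structures on the carriers, re-based on the canonical one by `Representation.ofIntModule`),
GRANTED the finiteness `finite_restrictedCohomology K` of the `Hʳ(G_S, ·)` (Harari Cor. 17.17 — the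
lane's brick B1c at totally complex `K`; only `r = 2` is used).

* `mem_of_natCard_mem_of_isPrimaryTorsion` — every finite place dividing `#Y` (`Y` finite
  `p`-primary) lies in `S ⊇ S_p`;
* `finite_restrictedCohomology_inflate` — under `finite_restrictedCohomology K`, the `Hʳ(G_S, Y)`
  of an inflated finite `p`-primary `Q`-module are finite;
* **`eulerChar_inflate_add`** — the additivity (`hψ`).

## References
* J. S. Milne, *Arithmetic Duality Theorems*, 2nd ed. (2006), I §5 Thm. 5.1, Lemma 5.3 (p. 69).
  [MilneADT2006]
* D. Harari, *Galois Cohomology and Class Field Theory* (2020), Cor. 17.17, Def. 15.36. [Harari2020]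
-/

noncomputable section

open CategoryTheory Function NumberField Field IsDedekindDomain
open scoped NumberField

namespace Literature.NumberTheory.GaloisCohomology

open Literature.NumberTheory.GaloisRepresentations
open Literature.NumberTheory.GaloisRepresentations.DiscreteGaloisModule (restrictedCohomology inflate)
open _root_.TopRep _root_.ContRepresentation _root_.ContinuousCohomology

variable {K : Type} [Field K] [NumberField K]

/-! ### §1. Finiteness inputs -/

section Finiteness

omit [NumberField K] in
/-- If `Y` is finite and `p`-primary, every finite place dividing `#Y` (a power of `p`) lies in any
`S ⊇ S_p`. [cite: MilneADT2006, I §5 (proof of Thm. 5.1, p. 69)] -/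
theorem mem_of_natCard_mem_of_isPrimaryTorsion [NumberField K] {S : Set (HeightOneSpectrum (𝓞 K))}
    (p : ℕ) [Fact p.Prime]
    (hSp : ∀ v : HeightOneSpectrum (𝓞 K), ((p : ℕ) : 𝓞 K) ∈ v.asIdeal → v ∈ S)
    {Y : Type} [AddCommGroup Y] [Finite Y] (hY : IsPrimaryTorsion p Y)
    (v : HeightOneSpectrum (𝓞 K)) (hv : ((Nat.card Y : ℕ) : 𝓞 K) ∈ v.asIdeal) : v ∈ S := by
  obtain ⟨k, hk⟩ := exists_card_eq_prime_pow Y hY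
  rw [hk, Nat.cast_pow] at hv
  exact hSp v (v.isPrime.mem_of_pow_mem _ hv)

/-- Under the finiteness fact `finite_restrictedCohomology K` (Harari Cor. 17.17; a THEOREM of the
tree at totally complex `K` once brick B1c lands), **`Hʳ(G_S, Y)` is finite** for the inflation of a
finite `p`-primary `Q`-module along a `π` killing `N_S`, `S ⊇ S_p` finite.
[cite: Harari2020, Cor. 17.17 (p. 295)] -/
theorem finite_restrictedCohomology_inflate (hfinK : finite_restrictedCohomology K)
    {S : Set (HeightOneSpectrum (𝓞 K))} (hSfin : S.Finite) (p : ℕ) [Fact p.Prime]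
    (hSp : ∀ v : HeightOneSpectrum (𝓞 K), ((p : ℕ) : 𝓞 K) ∈ v.asIdeal → v ∈ S)
    {Q : Type*} [Group Q] [TopologicalSpace Q] [DiscreteTopology Q]
    (π : absoluteGaloisGroup K →ₜ* Q) (hπ : ∀ σ ∈ ramificationSubgroup K S, π σ = 1)
    {Y : Type} [AddCommGroup Y] [TopologicalSpace Y] [DiscreteTopology Y] [Finite Y]
    (ρY : Representation ℤ Q Y) (hY : IsPrimaryTorsion p Y) (r : ℕ) :
    Finite (restrictedCohomology (inflate π ρY) S r) :=
  hfinK S hSfin Y (inflate π ρY) (DiscreteGaloisModule.isUnramifiedOutside_inflate π ρY S hπ)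
    (mem_of_natCard_mem_of_isPrimaryTorsion p hSp hY) r

end Finiteness

/-! ### §2. Additivity of `Y ↦ χ_{p,e}(inflate π Y)` on short exact sequences of `Q`-modules -/

section Additivity

variable [IsTotallyComplex K] {S : Set (HeightOneSpectrum (𝓞 K))}
variable {Q : Type*} [Group Q] [TopologicalSpace Q] [DiscreteTopology Q]
  (π : absoluteGaloisGroup K →ₜ* Q)

/-- **Milne's "`φ` is a homomorphism on `R_{𝔽_p}(Ḡ)`", additive `ℤ`-valued form** (the `hψ` of the
finite-group bricks).  `K` totally complex, `S ⊇ S_p` finite, `π : Γ_K →ₜ* Q` continuous onto a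
discrete group with `π(N_S) = 1`, and `finite_restrictedCohomology K` granted.  For every short
exact sequence `0 → X →(f) Y →(g) Z → 0` of `ℤ[Q]`-modules (ARBITRARY `ℤ`-module structures on the
carriers, `Q`-equivariant `ℤ`-linear `f`, `g`; `f` injective, `g` surjective, `range f = ker g`)
with `Y` finite and killed by `p`, and any exponent `e : ℕ`:

  `χ(Y) = χ(X) + χ(Z)`,  `χ(W) := v_p #H⁰(G_S, W̃) − v_p #H¹(G_S, W̃) + v_p #H²(G_S, W̃) + e·v_p #W`,

`W̃ = inflate π (Representation.ofIntModule _ ρW)` the inflated discrete `Γ_K`-module (carriers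
given the discrete topology by the caller), `Hⁿ(G_S, ·) = restrictedCohomology · S n`.
[cite: MilneADT2006, I §5 Lemma 5.3 and the sentence after it (p. 69)]
[cite: Harari2020, Cor. 17.17 and Def. 15.36] -/
theorem eulerChar_inflate_add (hfinK : finite_restrictedCohomology K) (hSfin : S.Finite)
    (p : ℕ) [Fact p.Prime]
    (hSp : ∀ v : HeightOneSpectrum (𝓞 K), ((p : ℕ) : 𝓞 K) ∈ v.asIdeal → v ∈ S)
    (hπ : ∀ σ ∈ ramificationSubgroup K S, π σ = 1) (e : ℕ)
    {X Y Z : Type} [AddCommGroup X] [instX : Module ℤ X] [AddCommGroup Y] [instY : Module ℤ Y]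
    [AddCommGroup Z] [instZ : Module ℤ Z]
    [TopologicalSpace X] [DiscreteTopology X] [TopologicalSpace Y] [DiscreteTopology Y]
    [TopologicalSpace Z] [DiscreteTopology Z]
    (ρX : Representation ℤ Q X) (ρY : Representation ℤ Q Y) (ρZ : Representation ℤ Q Z)
    (f : X →ₗ[ℤ] Y) (g : Y →ₗ[ℤ] Z)
    (hf : ∀ s x, f (ρX s x) = ρY s (f x)) (hg : ∀ s y, g (ρY s y) = ρZ s (g y))
    (hinj : Function.Injective f) (hsurj : Function.Surjective g)
    (hex : LinearMap.range f = LinearMap.ker g) (hYfin : Finite Y) (hpY : ∀ y : Y, (p : ℤ) • y = 0) :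
    ((padicValNat p (Nat.card (restrictedCohomology
            (inflate π (Representation.ofIntModule instY ρY)) S 0)) : ℤ) -
          padicValNat p (Nat.card (restrictedCohomology
            (inflate π (Representation.ofIntModule instY ρY)) S 1)) +
          padicValNat p (Nat.card (restrictedCohomology
            (inflate π (Representation.ofIntModule instY ρY)) S 2)) +
        e * padicValNat p (Nat.card Y)) =
      ((padicValNat p (Nat.card (restrictedCohomology
              (inflate π (Representation.ofIntModule instX ρX)) S 0)) : ℤ) -
            padicValNat p (Nat.card (restrictedCohomology
              (inflate π (Representation.ofIntModule instX ρX)) S 1)) +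
            padicValNat p (Nat.card (restrictedCohomology
              (inflate π (Representation.ofIntModule instX ρX)) S 2)) +
          e * padicValNat p (Nat.card X)) +
        ((padicValNat p (Nat.card (restrictedCohomology
              (inflate π (Representation.ofIntModule instZ ρZ)) S 0)) : ℤ) -
            padicValNat p (Nat.card (restrictedCohomology
              (inflate π (Representation.ofIntModule instZ ρZ)) S 1)) +
            padicValNat p (Nat.card (restrictedCohomology
              (inflate π (Representation.ofIntModule instZ ρZ)) S 2)) +
          e * padicValNat p (Nat.card Z)) := by
  -- re-base the three `ℤ`-module structures on the canonical ones
  have eX : instX = AddCommGroup.toIntModule X := Subsingleton.elim _ _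
  have eY : instY = AddCommGroup.toIntModule Y := Subsingleton.elim _ _
  have eZ : instZ = AddCommGroup.toIntModule Z := Subsingleton.elim _ _
  subst eX eY eZ
  haveI : Finite Y := hYfin
  haveI : Finite X := Finite.of_injective f hinj
  haveI : Finite Z := Finite.of_surjective g hsurj
  -- `p`-primarity of the three carriers
  have hYp : IsPrimaryTorsion p Y :=
    DiscreteGaloisModule.isPrimaryTorsion_of_forall_intModule_smul_eq_zero
      (AddCommGroup.toIntModule Y) hpY
  have hXp : IsPrimaryTorsion p X := fun x => by
    refine ⟨1, hinj ?_⟩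
    rw [map_nsmul, map_zero, pow_one, ← Nat.cast_smul_eq_nsmul ℤ]
    exact hpY (f x)
  have hZp : IsPrimaryTorsion p Z := fun z => by
    obtain ⟨y, rfl⟩ := hsurj z
    obtain ⟨r, hr⟩ := hYp y
    exact ⟨r, by rw [← map_nsmul, hr, map_zero]⟩
  -- the inflated short exact sequence of discrete `Γ_K`-modules
  have hS : IsSES
      (DiscreteGaloisModule.inflateHom π (ρY := Representation.ofIntModule _ ρX)
        (ρY' := Representation.ofIntModule _ ρY) f.toAddMonoidHom fun s x => hf s x)
      (DiscreteGaloisModule.inflateHom π (ρY := Representation.ofIntModule _ ρY)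
        (ρY' := Representation.ofIntModule _ ρZ) g.toAddMonoidHom fun s y => hg s y) :=
    DiscreteGaloisModule.isSES_inflateHom π f.toAddMonoidHom g.toAddMonoidHom _ _ hinj hsurj
      (fun x => LinearMap.mem_ker.1 (hex ▸ LinearMap.mem_range_self f x))
      (fun y hy => by
        have hy' : y ∈ LinearMap.ker g := LinearMap.mem_ker.2 hy
        rw [← hex] at hy'
        obtain ⟨x, hx⟩ := hy'
        exact ⟨x, hx⟩)
  -- finiteness of the `H²` of the first two terms (Harari Cor. 17.17, granted)
  haveI := finite_restrictedCohomology_inflate hfinK hSfin p hSp π hπ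
    (Representation.ofIntModule _ ρX) hXp 2
  haveI := finite_restrictedCohomology_inflate hfinK hSfin p hSp π hπ
    (Representation.ofIntModule _ ρY) hYp 2
  exact restrictedCohomology_eulerChar_add hSfin p hSp hS
    (DiscreteGaloisModule.isUnramifiedOutside_inflate π _ S hπ) hXp e

end Additivity

end Literature.NumberTheory.GaloisCohomology

end
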